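import Summits.AtomisticToContinuum.Crystallization.Theorems.HullExactificationCascadeZeroDefectDensityCoordsHcpBadCore
import HarnessLib

/-!
# Coordinates for the birth line of `ZeroDefectDensity` — III: the five bad points of an hcp shell
# (route `HullExactificationCascade`, crux `ZeroDefectDensity`, stmt-AtomisticToContinuum-12086; stub `stub_coordsHcp`)

Support file (lead c4, stub-worker) for the registered stub `stub_coordsHcp`.  In the setting of
`…CoordsHcpGood` (twelve shell vectors `p i` labelled by `hcpTab`, soft metric data at tolerance
`1/4000`), suppose an orthonormal basis `C` and a linear isometry `A` carrying the coordinate basis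
to `C` are given, together with the GOOD-point bounds `‖p r - A (hcpTab r/√18)‖ ≤ 0.013` for
`r = 0, 2, 4, 5, 6, 7, 8`.  The five BAD points — `1` and `3` (antipodes of the axis points `0`
and `2`, at the unpinned pattern distance `2`) and the lower triangle `9, 10, 11` (at the unpinned
distance `√(11/3)` from an axis point) — are then located to within `49/1000`:

* `hcp_inner_map_eq_sum`, `hcp_ideal_coord` — inner products with the images `A (hcpTab r/√18)` in the
  coordinates `⟪p t, C k⟫`; `hcp_norm_le_of_forall_coord`, `hcp_norm_le_of_three_coord` — Parseval, bound
  form with the square root taken (used again by the stub file);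
* `hcp_bad` — the five bounds `‖p t - A (hcpTab t/√18)‖ ≤ 49/1000`, `t = 1, 3, 9, 10, 11`, from the
  real-arithmetic cores of `…CoordsHcpBadCore`; `hcp_bad_coords` — its registered one-line form.

Elementary. [folklore]
-/

noncomputable section

namespace Summit.AtomisticToContinuum.Crystallization.Theorems.ZeroDefectDensityBirth

open Real RealInnerProductSpace Literature.Geometry.DiscreteGeometry

/-! ### Coordinates with respect to an orthonormal basis, and the image of the pattern -/

/-- For a linear isometry with `A (B i) = C i`: `⟪x, A q⟫ = Σᵢ ⟪x, C i⟫ ⟪q, B i⟫`. [folklore] -/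
theorem hcp_inner_map_eq_sum (B C : OrthonormalBasis (Fin 3) ℝ (EuclideanSpace ℝ (Fin 3)))
    (A : EuclideanSpace ℝ (Fin 3) →ₗᵢ[ℝ] EuclideanSpace ℝ (Fin 3)) (hA : ∀ i, A (B i) = C i)
    (x q : EuclideanSpace ℝ (Fin 3)) : ⟪x, A q⟫ = ∑ i, ⟪x, C i⟫ * ⟪q, B i⟫ := by
  have hq : A q = ∑ i, ⟪q, B i⟫ • C i := by
    conv_lhs => rw [← B.sum_repr' q]
    rw [map_sum]
    refine Finset.sum_congr rfl fun i _ => ?_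
    rw [LinearIsometry.map_smul, hA, real_inner_comm]
  rw [hq, inner_sum]
  refine Finset.sum_congr rfl fun i _ => ?_
  rw [real_inner_smul_right, mul_comm]

/-- Parseval, bound form with the square root taken: coordinate errors `ε k` with `Σ ε k² ≤ R²`
give `‖x - A q‖ ≤ R`. [folklore] -/
theorem hcp_norm_le_of_forall_coord (B C : OrthonormalBasis (Fin 3) ℝ (EuclideanSpace ℝ (Fin 3)))
    (A : EuclideanSpace ℝ (Fin 3) →ₗᵢ[ℝ] EuclideanSpace ℝ (Fin 3)) (hA : ∀ i, A (B i) = C i)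
    {x q : EuclideanSpace ℝ (Fin 3)} (ε : Fin 3 → ℝ) {R : ℝ} (hR : 0 ≤ R)
    (h : ∀ k, |⟪x, C k⟫ - ⟪q, B k⟫| ≤ ε k) (hε : ∑ k, ε k ^ 2 ≤ R ^ 2) : ‖x - A q‖ ≤ R :=
  (sq_le_sq₀ (norm_nonneg _) hR).1 ((norm_sub_map_sq_le B C A hA x q ε h).trans hε)

/-- Parseval, bound form with three explicit coordinate errors. [folklore] -/
theorem hcp_norm_le_of_three_coord (B C : OrthonormalBasis (Fin 3) ℝ (EuclideanSpace ℝ (Fin 3)))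
    (A : EuclideanSpace ℝ (Fin 3) →ₗᵢ[ℝ] EuclideanSpace ℝ (Fin 3)) (hA : ∀ i, A (B i) = C i)
    {x q : EuclideanSpace ℝ (Fin 3)} {ε₀ ε₁ ε₂ R : ℝ} (hR : 0 ≤ R)
    (h0 : |⟪x, C 0⟫ - ⟪q, B 0⟫| ≤ ε₀) (h1 : |⟪x, C 1⟫ - ⟪q, B 1⟫| ≤ ε₁)
    (h2 : |⟪x, C 2⟫ - ⟪q, B 2⟫| ≤ ε₂) (hε : ε₀ ^ 2 + ε₁ ^ 2 + ε₂ ^ 2 ≤ R ^ 2) : ‖x - A q‖ ≤ R :=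
  hcp_norm_le_of_forall_coord B C A hA ![ε₀, ε₁, ε₂] hR (fun k => by fin_cases k <;> assumption)
    (by rw [Fin.sum_univ_three]; exact hε)

/-- Coordinates of the hcp pattern points: `⟪hcpTab i/√18, e_k⟫ = (hcpTab i k)/√18`. [folklore] -/
theorem hcp_ideal_coord {q : Fin 12 → EuclideanSpace ℝ (Fin 3)}
    (hq : ∀ i, q i = (Real.sqrt 18)⁻¹ • intVec (hcpTab i)) (i : Fin 12) (k : Fin 3) :
    ⟪q i, (EuclideanSpace.basisFun (Fin 3) ℝ) k⟫ = (Real.sqrt 18)⁻¹ * ((hcpTab i k : ℤ) : ℝ) := by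
  rw [hq i, EuclideanSpace.basisFun_apply]
  simp [EuclideanSpace.inner_single_right, intVec_apply]

/-! ### The five bad points -/

/-- **The five bad points of a soft hcp shell.**  See the module docstring. [folklore] -/
theorem hcp_bad {p q : Fin 12 → EuclideanSpace ℝ (Fin 3)}
    {C : OrthonormalBasis (Fin 3) ℝ (EuclideanSpace ℝ (Fin 3))}
    {A : EuclideanSpace ℝ (Fin 3) →ₗᵢ[ℝ] EuclideanSpace ℝ (Fin 3)}
    (hn : ∀ i, 1 - 1 / 4000 ≤ ‖p i‖ ∧ ‖p i‖ ≤ 1 + 1 / 4000)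
    (h1 : ∀ i j, sqNormInt (hcpTab i - hcpTab j) = 18 →
      1 - 1 / 4000 ≤ ‖p i - p j‖ ∧ ‖p i - p j‖ ≤ 1 + 1 / 4000)
    (h2 : ∀ i j, sqNormInt (hcpTab i - hcpTab j) = 36 → |‖p i - p j‖ ^ 2 - 2| ≤ 38 / 4000)
    (h3 : ∀ i j, sqNormInt (hcpTab i - hcpTab j) = 54 → |‖p i - p j‖ ^ 2 - 3| ≤ 40 / 4000)
    (h83 : ∀ i j, sqNormInt (hcpTab i - hcpTab j) = 48 → |‖p i - p j‖ ^ 2 - 8 / 3| ≤ 60 / 4000)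
    (hq : ∀ i, q i = (Real.sqrt 18)⁻¹ • intVec (hcpTab i))
    (hA : ∀ k, A ((EuclideanSpace.basisFun (Fin 3) ℝ) k) = C k)
    (hg0 : ‖p 0 - A (q 0)‖ ≤ 0.013) (hg2 : ‖p 2 - A (q 2)‖ ≤ 0.013) (hg4 : ‖p 4 - A (q 4)‖ ≤ 0.013)
    (hg5 : ‖p 5 - A (q 5)‖ ≤ 0.013) (hg6 : ‖p 6 - A (q 6)‖ ≤ 0.013) (hg7 : ‖p 7 - A (q 7)‖ ≤ 0.013)
    (hg8 : ‖p 8 - A (q 8)‖ ≤ 0.013) :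
    ‖p 1 - A (q 1)‖ ≤ 49 / 1000 ∧ ‖p 3 - A (q 3)‖ ≤ 49 / 1000 ∧ ‖p 9 - A (q 9)‖ ≤ 49 / 1000 ∧
    ‖p 10 - A (q 10)‖ ≤ 49 / 1000 ∧ ‖p 11 - A (q 11)‖ ≤ 49 / 1000 := by
  -- Gram entries from the metric data
  have e : ∀ i, |‖p i‖ ^ 2 - 1| ≤ 0.0005001 := fun i => hcp_abs_sq_sub_one_le (hn i)
  have G1 : ∀ i j, sqNormInt (hcpTab i - hcpTab j) = 18 → |⟪p i, p j⟫ - 1 / 2| ≤ 0.00075015 :=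
    fun i j h => hcp_inner_approx (e i) (e j) (hcp_abs_sq_sub_one_le (h1 i j h)) (by norm_num) (by norm_num)
  have G2 : ∀ i j, sqNormInt (hcpTab i - hcpTab j) = 36 → |⟪p i, p j⟫ - 0| ≤ 0.0052501 :=
    fun i j h => hcp_inner_approx (e i) (e j) (h2 i j h) (by norm_num) (by norm_num)
  have G3 : ∀ i j, sqNormInt (hcpTab i - hcpTab j) = 54 → |⟪p i, p j⟫ - (-1 / 2)| ≤ 0.0055001 :=
    fun i j h => hcp_inner_approx (e i) (e j) (h3 i j h) (by norm_num) (by norm_num)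
  have G83 : ∀ i j, sqNormInt (hcpTab i - hcpTab j) = 48 → |⟪p i, p j⟫ - (-1 / 3)| ≤ 0.0080001 :=
    fun i j h => hcp_inner_approx (e i) (e j) (h83 i j h) (by norm_num) (by norm_num)
  -- squared norms in coordinates
  have nrm : ∀ i, |⟪p i, C 0⟫ ^ 2 + ⟪p i, C 1⟫ ^ 2 + ⟪p i, C 2⟫ ^ 2 - 1| ≤ 0.0005001 := fun i => by
    have h := C.sum_sq_inner_left (p i)
    rw [Fin.sum_univ_three] at h
    rw [h]; exact e i
  -- pinned inner products with good reference points, in coordinates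
  have hqB := hcp_ideal_coord hq
  have ref : ∀ (t r : Fin 12) (n₀ n₁ n₂ : ℝ) {β er : ℝ}, |⟪p t, p r⟫ - β| ≤ er →
      ‖p r - A (q r)‖ ≤ 0.013 →
      (((hcpTab r 0 : ℤ) : ℝ) = n₀ ∧ ((hcpTab r 1 : ℤ) : ℝ) = n₁ ∧ ((hcpTab r 2 : ℤ) : ℝ) = n₂) →
      |√2 / 6 * (n₀ * ⟪p t, C 0⟫ + n₁ * ⟪p t, C 1⟫ + n₂ * ⟪p t, C 2⟫) - β| ≤ er + 0.0130033 := by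
    intro t r n₀ n₁ n₂ β er hβ hg ht
    have hI : ⟪p t, A (q r)⟫ = √2 / 6 * (n₀ * ⟪p t, C 0⟫ + n₁ * ⟪p t, C 1⟫ + n₂ * ⟪p t, C 2⟫) := by
      rw [hcp_inner_map_eq_sum _ C A hA, Fin.sum_univ_three, hqB, hqB, hqB, ht.1, ht.2.1, ht.2.2,
        hcp_inv_sqrt_eighteen]
      ring
    have hd : |⟪p t, A (q r)⟫ - ⟪p t, p r⟫| ≤ 0.0130033 := by
      rw [← inner_sub_right]
      calc |⟪p t, A (q r) - p r⟫| ≤ ‖p t‖ * ‖A (q r) - p r‖ := abs_real_inner_le_norm _ _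
        _ ≤ (1 + 1 / 4000) * 0.013 :=
            mul_le_mul (hn t).2 (by rwa [norm_sub_rev]) (norm_nonneg _) (by norm_num)
        _ ≤ 0.0130033 := by norm_num
    rw [← hI]
    calc |⟪p t, A (q r)⟫ - β| = |(⟪p t, A (q r)⟫ - ⟪p t, p r⟫) + (⟪p t, p r⟫ - β)| := by ring_nf
      _ ≤ |⟪p t, A (q r)⟫ - ⟪p t, p r⟫| + |⟪p t, p r⟫ - β| := abs_add_le _ _
      _ ≤ 0.0130033 + er := add_le_add hd hβ
      _ = er + 0.0130033 := add_comm _ _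
  have fin : ∀ (t : Fin 12) {ε₀ ε₁ ε₂ : ℝ},
      |⟪p t, C 0⟫ - (Real.sqrt 18)⁻¹ * ((hcpTab t 0 : ℤ) : ℝ)| ≤ ε₀ →
      |⟪p t, C 1⟫ - (Real.sqrt 18)⁻¹ * ((hcpTab t 1 : ℤ) : ℝ)| ≤ ε₁ →
      |⟪p t, C 2⟫ - (Real.sqrt 18)⁻¹ * ((hcpTab t 2 : ℤ) : ℝ)| ≤ ε₂ →
      ε₀ ^ 2 + ε₁ ^ 2 + ε₂ ^ 2 ≤ (49 / 1000) ^ 2 → ‖p t - A (q t)‖ ≤ 49 / 1000 := by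
    intro t ε₀ ε₁ ε₂ c0 c1 c2 hε
    exact hcp_norm_le_of_three_coord _ C A hA (by norm_num)
      (by rw [hqB]; exact c0) (by rw [hqB]; exact c1) (by rw [hqB]; exact c2) hε
  refine ⟨?_, ?_, ?_, ?_, ?_⟩
  · -- point 1: references 4, 8; witness 2
    obtain ⟨c0, c1, c2⟩ := hcp_bad_pt1 ⟪p 1, C 0⟫ ⟪p 1, C 1⟫ ⟪p 1, C 2⟫
      ((ref 1 4 0 3 (-3) (G1 1 4 (by decide)) hg4 (by simp [hcpTab])).trans (by norm_num))
      ((ref 1 8 0 3 3 (G1 1 8 (by decide)) hg8 (by simp [hcpTab])).trans (by norm_num)) (nrm 1)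
      ((ref 1 2 3 0 (-3) (G3 1 2 (by decide)) hg2 (by simp [hcpTab])).trans (by norm_num))
    exact fin 1 c0 c1 c2 (by norm_num)
  · -- point 3: references 5, 8; witness 0
    obtain ⟨c0, c1, c2⟩ := hcp_bad_pt3 ⟪p 3, C 0⟫ ⟪p 3, C 1⟫ ⟪p 3, C 2⟫
      ((ref 3 5 0 (-3) 3 (G1 3 5 (by decide)) hg5 (by simp [hcpTab])).trans (by norm_num))
      ((ref 3 8 0 3 3 (G1 3 8 (by decide)) hg8 (by simp [hcpTab])).trans (by norm_num)) (nrm 3)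
      ((ref 3 0 3 (-3) 0 (G3 3 0 (by decide)) hg0 (by simp [hcpTab])).trans (by norm_num))
    exact fin 3 c0 c1 c2 (by norm_num)
  · -- point 9: references 0, 6; witness 2
    obtain ⟨c0, c1, c2⟩ := hcp_bad_pt9 ⟪p 9, C 0⟫ ⟪p 9, C 1⟫ ⟪p 9, C 2⟫
      ((ref 9 0 3 (-3) 0 (G2 9 0 (by decide)) hg0 (by simp [hcpTab])).trans (by norm_num))
      ((ref 9 6 3 3 0 (G83 9 6 (by decide)) hg6 (by simp [hcpTab])).trans (by norm_num)) (nrm 9)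
      ((ref 9 2 3 0 (-3) (G1 9 2 (by decide)) hg2 (by simp [hcpTab])).trans (by norm_num))
    exact fin 9 c0 c1 c2 (by norm_num)
  · -- point 10: references 2, 7; witness 0
    obtain ⟨c0, c1, c2⟩ := hcp_bad_pt10 ⟪p 10, C 0⟫ ⟪p 10, C 1⟫ ⟪p 10, C 2⟫
      ((ref 10 2 3 0 (-3) (G2 10 2 (by decide)) hg2 (by simp [hcpTab])).trans (by norm_num))
      ((ref 10 7 3 0 3 (G83 10 7 (by decide)) hg7 (by simp [hcpTab])).trans (by norm_num)) (nrm 10)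
      ((ref 10 0 3 (-3) 0 (G1 10 0 (by decide)) hg0 (by simp [hcpTab])).trans (by norm_num))
    exact fin 10 c0 c1 c2 (by norm_num)
  · -- point 11: references 4, 8; witness 0
    obtain ⟨c0, c1, c2⟩ := hcp_bad_pt11 ⟪p 11, C 0⟫ ⟪p 11, C 1⟫ ⟪p 11, C 2⟫
      ((ref 11 4 0 3 (-3) (G2 11 4 (by decide)) hg4 (by simp [hcpTab])).trans (by norm_num))
      ((ref 11 8 0 3 3 (G83 11 8 (by decide)) hg8 (by simp [hcpTab])).trans (by norm_num)) (nrm 11)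
      ((ref 11 0 3 (-3) 0 (G3 11 0 (by decide)) hg0 (by simp [hcpTab])).trans (by norm_num))
    exact fin 11 c0 c1 c2 (by norm_num)

/-- **Registered sub-goal `hcp_bad_coords`** (one-line form of `hcp_bad`, lead c4 stub-worker).
[folklore] -/
theorem hcp_bad_coords : ∀ (p q : Fin 12 → EuclideanSpace ℝ (Fin 3)) (C : OrthonormalBasis (Fin 3) ℝ (EuclideanSpace ℝ (Fin 3))) (A : EuclideanSpace ℝ (Fin 3) →ₗᵢ[ℝ] EuclideanSpace ℝ (Fin 3)), (∀ i, 1 - 1 / 4000 ≤ ‖p i‖ ∧ ‖p i‖ ≤ 1 + 1 / 4000) → (∀ i j, Literature.Geometry.DiscreteGeometry.sqNormInt (Literature.Geometry.DiscreteGeometry.hcpTab i - Literature.Geometry.DiscreteGeometry.hcpTab j) = 18 → 1 - 1 / 4000 ≤ ‖p i - p j‖ ∧ ‖p i - p j‖ ≤ 1 + 1 / 4000) → (∀ i j, Literature.Geometry.DiscreteGeometry.sqNormInt (Literature.Geometry.DiscreteGeometry.hcpTab i - Literature.Geometry.DiscreteGeometry.hcpTab j) = 36 → |‖p i - p j‖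 ^ 2 - 2| ≤ 38 / 4000) → (∀ i j, Literature.Geometry.DiscreteGeometry.sqNormInt (Literature.Geometry.DiscreteGeometry.hcpTab i - Literature.Geometry.DiscreteGeometry.hcpTab j) = 54 → |‖p i - p j‖ ^ 2 - 3| ≤ 40 / 4000) → (∀ i j, Literature.Geometry.DiscreteGeometry.sqNormInt (Literature.Geometry.DiscreteGeometry.hcpTab i - Literature.Geometry.DiscreteGeometry.hcpTab j) = 48 → |‖p i - p j‖ ^ 2 - 8 / 3| ≤ 60 / 4000) → (∀ i, q i = (Real.sqrt 18)⁻¹ • Literature.Geometry.DiscreteGeometry.intVec (Literature.Geometry.DiscreteGeometry.hcpTab i)) → (∀ k, A ((EuclideanSpace.basisFun (Fin 3) ℝ) k) = C k) → ‖p 0 - A (q 0)‖ ≤ 0.013 → ‖p 2 - A (q 2)‖ ≤ 0.013 → ‖p 4 - A (q 4)‖ ≤ 0.013 → ‖p 5 - A (q 5)‖ ≤ 0.013 → ‖p 6 - A (q 6)‖ ≤ 0.013 → ‖p 7 - A (q 7)‖ ≤ 0.013 → ‖p 8 - A (q 8)‖ ≤ 0.013 → ‖p 1 - A (q 1)‖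 ≤ 49 / 1000 ∧ ‖p 3 - A (q 3)‖ ≤ 49 / 1000 ∧ ‖p 9 - A (q 9)‖ ≤ 49 / 1000 ∧ ‖p 10 - A (q 10)‖ ≤ 49 / 1000 ∧ ‖p 11 - A (q 11)‖ ≤ 49 / 1000 :=
  fun _ _ _ _ hn h1 h2 h3 h83 hq hA hg0 hg2 hg4 hg5 hg6 hg7 hg8 =>
    hcp_bad hn h1 h2 h3 h83 hq hA hg0 hg2 hg4 hg5 hg6 hg7 hg8

end Summit.AtomisticToContinuum.Crystallization.Theorems.ZeroDefectDensityBirth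

end
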